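import Summits.NavierStokesRegularity.NavierStokesRegularity.Theorems.PerpetualPumpCircuitPumpGateSigma
import Summits.NavierStokesRegularity.NavierStokesRegularity.Theorems.PerpetualPumpCircuitPumpRiseClock

/-!
# Gate radius tracking for the damped Toda transfer gate (crux `PerpetualPump.CircuitPump`,
# stmt-NavierStokesRegularity-1834; line `singular-clock-gspt`, sub-goal `toda_gate_R` of `stub_clockBox`)

Pure real analysis for the gate `u' = -u - v² + p`, `v' = v(u - w) - v + s`, `w' = -ν w + v² + r`
on `[0, T]`, `T ≤ 1/2` (`|p|, |r| ≤ P`, `0 ≤ s ≤ P`, `ν ∈ [1, 2]`, `u(0) = A ≥ 1000(1 + P)`,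
`w(0) ∈ [0, 1]`, `v(0) ∈ (0, 1]`), on top of the landed σ-lemma `toda_gate_sigma` and the rise
lemmas `riseClock_boot`, `riseClock_phase`. With `D = u - w`, `R = √(D² + 2v²)`:
* `gateR_hasDerivWithinAt`: the EXACT radius law `R' = -R + N/R`, `N = (ν-1) D w + D(p-r) + 2vs`
  (chain rule and `R² = D² + 2v²`; this is `R' = -k_R R + (ν-1)v²/R + (ν-1)Dσ/(2R) + π_R` with
  `w = (R + σ - D)/2`); `gateR_pointwise`: `|D| ≤ R`, `|D(p-r) + 2vs| ≤ 4PR`;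
* `gateR_rise` (a): on a rise interval (`D ≥ A/2 + 1`, `-Pt ≤ w ≤ 1 + v²/A + Pt`) one has
  `-Pt ≤ D w/R ≤ 1 + v²/A + Pt`, and the bond growth `2vv' ≥ Av²` makes `(ν-1)v²/A²` a Lyapunov
  majorant of the drained term `(ν-1)v²/A`; exponential barriers at rate `-1`
  (`Literature.Analysis.ODE.OneSidedComparison`) for `R - Ae^{-t} ∓ (…)` give
  `|R - Ae^{-t}| ≤ 1 + (ν-1)(1/64 + 1/2) + 4.5Pt`;
* `gateR_flip` (b): while `D ≤ 0`, `v ≤ 2`: `R' + νR = (ν-1)(R² + Dw)/R + π_R`,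
  `R² + Dw = (2R-D)(R+D)/2 + Dσ/2`, `0 ≤ (2R-D)(R+D)/2 ≤ 2v² ≤ 8` (`gateR_flip_pointwise`), so
  `|R' + νR| ≤ M = 24(ν-1)/A + (ν-1)(2 + 15(ν-1) + 3P)/2 + 4P`; barriers at rate `-ν` for
  `R - R(t₁)e^{-ν(t-t₁)} ∓ M(t - t₁)` give the error `M/2 ≤ 3 + 3(ν-1) + 4P`;
* `toda_gate_R`: assembly (`toda_gate_sigma` supplies `v ≥ 0`, `w ≥ -Pt`, `R ≥ A/3`, `|σ| ≤ …`).
[folklore]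
-/

noncomputable section

-- the summit namespace `…NavierStokesRegularity.NavierStokesRegularity…` is the tree convention
set_option linter.dupNamespace false

namespace Summit.NavierStokesRegularity.NavierStokesRegularity.Theorems.PerpetualPumpCircuitPump

open Set Literature.Analysis.ODE

/-- **The exact radius law of the damped Toda gate.** With `u' = -u - v² + a`,
`v' = v(u - w) - v + c`, `w' = -ν w + v² + b` at `t` and `R = √((u - w)² + 2v²) > 0`, the radius
has right derivative `-R + ((ν - 1)(u - w) w + ((u - w)(a - b) + 2 v c)) / R` (chain rule and
`R² = (u - w)² + 2v²`). [folklore] -/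
theorem gateR_hasDerivWithinAt {u v w : ℝ → ℝ} {ν a b c t R : ℝ}
    (hu : HasDerivWithinAt u (-u t - v t ^ 2 + a) (Ici t) t)
    (hv : HasDerivWithinAt v (v t * (u t - w t) - v t + c) (Ici t) t)
    (hw : HasDerivWithinAt w (-ν * w t + v t ^ 2 + b) (Ici t) t)
    (hR : Real.sqrt ((u t - w t) ^ 2 + 2 * v t ^ 2) = R) (hR0 : 0 < R) :
    HasDerivWithinAt (fun y => Real.sqrt ((u y - w y) ^ 2 + 2 * v y ^ 2))
      (-R + ((ν - 1) * (u t - w t) * w t + ((u t - w t) * (a - b) + 2 * v t * c)) / R)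
      (Ici t) t := by
  have hQ0 : 0 < (u t - w t) ^ 2 + 2 * v t ^ 2 := Real.sqrt_pos.mp (hR ▸ hR0)
  have hQ : HasDerivWithinAt (fun y => (u y - w y) ^ 2 + 2 * v y ^ 2)
      (2 * (u t - w t) * ((-u t - v t ^ 2 + a) - (-ν * w t + v t ^ 2 + b)) +
        2 * (2 * v t * (v t * (u t - w t) - v t + c))) (Ici t) t := by
    refine (((hu.sub hw).fun_pow 2).add ((hv.fun_pow 2).const_mul 2)).congr_deriv ?_
    norm_num
  have h := hQ.sqrt hQ0.ne'
  rw [hR] at h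
  refine h.congr_deriv ?_
  have hR2 : R ^ 2 = (u t - w t) ^ 2 + 2 * v t ^ 2 := by rw [← hR]; exact Real.sq_sqrt hQ0.le
  field_simp
  linear_combination hR2

/-- **Pointwise gate-radius bounds.** With `R = √((U - W)² + 2V²) > 0`, `|a|, |b| ≤ P`,
`0 ≤ c ≤ P`: `|U - W| ≤ R` and `|(U - W)(a - b) + 2 V c| ≤ 4 P R`. [folklore] -/
theorem gateR_pointwise {U V W a b c P R : ℝ} (hR : Real.sqrt ((U - W) ^ 2 + 2 * V ^ 2) = R)
    (hR0 : 0 < R) (ha : |a| ≤ P) (hb : |b| ≤ P) (hc : 0 ≤ c ∧ c ≤ P) :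
    |U - W| ≤ R ∧ |(U - W) * (a - b) + 2 * V * c| ≤ 4 * P * R := by
  have hR2 : R ^ 2 = (U - W) ^ 2 + 2 * V ^ 2 := by
    rw [← hR]; exact Real.sq_sqrt (by positivity)
  have hD : |U - W| ≤ R := abs_le_of_sq_le_sq (by nlinarith [sq_nonneg V]) hR0.le
  have hV : |V| ≤ R :=
    abs_le_of_sq_le_sq (by nlinarith [sq_nonneg (U - W), sq_nonneg V]) hR0.le
  refine ⟨hD, ?_⟩
  have hab : |a - b| ≤ 2 * P := (abs_sub a b).trans (by linarith)
  have e1 : |U - W| * |a - b| ≤ R * (2 * P) := mul_le_mul hD hab (abs_nonneg _) hR0.le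
  have e2 : |V| * c ≤ R * P := mul_le_mul hV hc.2 hc.1 hR0.le
  calc |(U - W) * (a - b) + 2 * V * c| ≤ |(U - W) * (a - b)| + |2 * V * c| := abs_add_le _ _
    _ = |U - W| * |a - b| + 2 * (|V| * c) := by
        rw [abs_mul, abs_mul, abs_mul, abs_two, abs_of_nonneg hc.1, mul_assoc]
    _ ≤ 4 * P * R := by linarith

/-- **Rise regime (a).** On a rise interval `[0, t]` (`u - w ≥ A/2 + 1`, `w ≤ 1 + v²/A + Pτ`,
`v ≤ A/8` there; `v ≥ 0`, `w ≥ -Pτ` on `[0, T]`): `|R(t) - A e^{-t}| ≤ 3 + 25(ν - 1) + 8Pt`, by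
barriers at rate `-1` for `E - (ν-1)v²/A² - Mτ` and `E + Mτ`, `E = R - Ae^{-τ}`,
`M = (ν-1)(1 + P/2) + 4P` (`(v²)' ≥ A v²` absorbs the drained term), from `|R(0) - A| ≤ 1`.
[folklore] -/
theorem gateR_rise {ν P T A t : ℝ} {u v w p r s : ℝ → ℝ} (hν1 : 1 ≤ ν)
    (hν2 : ν ≤ 2) (hP : 0 ≤ P) (hT : T ≤ 1 / 2) (hA : 1000 * (1 + P) ≤ A) (hu0 : u 0 = A)
    (hw0 : 0 ≤ w 0) (hw1 : w 0 ≤ 1) (hv1 : v 0 ≤ 1) (hu : ContinuousOn u (Icc 0 T))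
    (hv : ContinuousOn v (Icc 0 T)) (hw : ContinuousOn w (Icc 0 T))
    (hu' : ∀ t ∈ Ico 0 T, HasDerivWithinAt u (-u t - v t ^ 2 + p t) (Ici t) t)
    (hv' : ∀ t ∈ Ico 0 T, HasDerivWithinAt v (v t * (u t - w t) - v t + s t) (Ici t) t)
    (hw' : ∀ t ∈ Ico 0 T, HasDerivWithinAt w (-ν * w t + v t ^ 2 + r t) (Ici t) t)
    (hp : ∀ t ∈ Icc 0 T, |p t| ≤ P) (hr : ∀ t ∈ Icc 0 T, |r t| ≤ P)
    (hs : ∀ t ∈ Icc 0 T, 0 ≤ s t ∧ s t ≤ P)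
    (hvp : ∀ t ∈ Icc 0 T, 0 ≤ v t) (hwlo : ∀ t ∈ Icc 0 T, -(P * t) ≤ w t)
    (ht : t ∈ Icc 0 T) (hv8 : ∀ t' ∈ Icc 0 t, v t' ≤ A / 8)
    (hD : ∀ τ ∈ Icc 0 t, A / 2 + 1 ≤ u τ - w τ)
    (hwup : ∀ τ ∈ Icc 0 t, w τ ≤ 1 + v τ ^ 2 / A + P * τ) :
    |Real.sqrt ((u t - w t) ^ 2 + 2 * v t ^ 2) - A * Real.exp (-t)| ≤
      3 + 25 * (ν - 1) + 8 * P * t := by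
  set R : ℝ → ℝ := fun τ => Real.sqrt ((u τ - w τ) ^ 2 + 2 * v τ ^ 2) with hRdef
  set N : ℝ → ℝ := fun τ => (ν - 1) * (u τ - w τ) * w τ +
    ((u τ - w τ) * (p τ - r τ) + 2 * v τ * s τ) with hNdef
  have hA0 : 0 < A := by linarith
  have hν0 : 0 ≤ ν - 1 := sub_nonneg.2 hν1
  have hI : Icc 0 t ⊆ Icc 0 T := Icc_subset_Icc_right ht.2
  have hI' : ∀ {τ}, τ ∈ Ico 0 t → τ ∈ Ico 0 T := fun hτ =>
    ⟨hτ.1, hτ.2.trans_le ht.2⟩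
  have hRpos : ∀ τ ∈ Icc 0 t, 0 < R τ := fun τ hτ =>
    Real.sqrt_pos.mpr (by nlinarith [hD τ hτ, sq_nonneg (v τ)])
  have hRc : ContinuousOn R (Icc 0 t) :=
    ((((hu.sub hw).pow 2).add ((hv.pow 2).const_mul 2)).sqrt).mono hI
  -- `E = R - A e^{-τ}` has `E' = -E + N / R`
  have hE' : ∀ τ ∈ Ico 0 t, HasDerivWithinAt (fun y => R y - A * Real.exp (-y))
      (-(R τ - A * Real.exp (-τ)) + N τ / R τ) (Ici τ) τ := fun τ hτ =>
    ((gateR_hasDerivWithinAt (hu' τ (hI' hτ)) (hv' τ (hI' hτ)) (hw' τ (hI' hτ)) rfl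
      (hRpos τ (Ico_subset_Icc_self hτ))).sub
      (((hasDerivAt_neg' τ).exp.const_mul A).hasDerivWithinAt)).congr_deriv (by ring)
  have hEc : ContinuousOn (fun y => R y - A * Real.exp (-y)) (Icc 0 t) := hRc.sub (by fun_prop)
  -- pointwise bounds on the forcing `N / R`
  have hNb : ∀ τ ∈ Ico 0 t, N τ / R τ ≤ (ν - 1) * (1 + v τ ^ 2 / A + P * τ) + 4 * P ∧
      -((ν - 1) * (P * τ) + 4 * P) ≤ N τ / R τ := by
    intro τ hτ
    have hτ' : τ ∈ Icc 0 T := hI (Ico_subset_Icc_self hτ)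
    have hR0 := hRpos τ (Ico_subset_Icc_self hτ)
    obtain ⟨hDR, hπ⟩ := gateR_pointwise rfl hR0 (hp τ hτ') (hr τ hτ') (hs τ hτ')
    have hD0 : 0 ≤ u τ - w τ := by linarith [hD τ (Ico_subset_Icc_self hτ)]
    have hDR' : u τ - w τ ≤ R τ := (abs_le.mp hDR).2
    have hPτ : 0 ≤ P * τ := mul_nonneg hP hτ.1
    have hWup0 : 0 ≤ 1 + v τ ^ 2 / A + P * τ := by
      linarith [div_nonneg (sq_nonneg (v τ)) hA0.le]
    obtain ⟨hπ1, hπ2⟩ := abs_le.mp hπ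
    have h1 : (u τ - w τ) * w τ ≤ R τ * (1 + v τ ^ 2 / A + P * τ) :=
      (mul_le_mul_of_nonneg_left (hwup τ (Ico_subset_Icc_self hτ)) hD0).trans
        (mul_le_mul_of_nonneg_right hDR' hWup0)
    have h2 : R τ * (-(P * τ)) ≤ (u τ - w τ) * w τ :=
      (mul_le_mul_of_nonpos_right hDR' (by linarith)).trans
        (mul_le_mul_of_nonneg_left (hwlo τ hτ') hD0)
    rw [div_le_iff₀ hR0, le_div_iff₀ hR0, hNdef]
    have h1' := mul_le_mul_of_nonneg_left h1 hν0
    have h2' := mul_le_mul_of_nonneg_left h2 hν0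
    constructor <;> linarith
  -- bond growth `A v² ≤ (v²)'`
  have hvv : ∀ τ ∈ Ico 0 t,
      A * v τ ^ 2 ≤ 2 * v τ * (v τ * (u τ - w τ) - v τ + s τ) := by
    intro τ hτ
    have hv0 := hvp τ (hI (Ico_subset_Icc_self hτ))
    have h1 := mul_nonneg (mul_nonneg hv0 hv0)
      (by linarith [hD τ (Ico_subset_Icc_self hτ)] : (0 : ℝ) ≤ u τ - w τ - 1 - A / 2)
    nlinarith [mul_nonneg hv0 (hs τ (hI (Ico_subset_Icc_self hτ))).1]
  have hv2' : ∀ τ ∈ Ico 0 t, HasDerivWithinAt (fun y => v y ^ 2)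
      (2 * v τ * (v τ * (u τ - w τ) - v τ + s τ)) (Ici τ) τ := fun τ hτ =>
    ((hv' τ (hI' hτ)).fun_pow 2).congr_deriv (by norm_num)
  set M : ℝ := (ν - 1) * (1 + P / 2) + 4 * P with hM
  have hM0 : 0 ≤ M := by positivity
  have hPτ2 : ∀ τ ∈ Ico 0 t, (ν - 1) * (P * τ) ≤ (ν - 1) * (P * (1 / 2)) := fun τ hτ =>
    mul_le_mul_of_nonneg_left (mul_le_mul_of_nonneg_left (by linarith [hτ.2, ht.2]) hP) hν0
  have hR0lo : A - w 0 ≤ R 0 :=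
    (Real.le_sqrt' (by linarith)).mpr (by rw [hu0]; linarith [sq_nonneg (v 0)])
  have hR0hi : R 0 ≤ A - w 0 + 1 := by
    have hv2 : v 0 ^ 2 ≤ 1 := pow_le_one₀ (hvp 0 ⟨le_rfl, ht.1.trans ht.2⟩) hv1
    exact Real.sqrt_le_iff.mpr ⟨by linarith, by rw [hu0]; linarith⟩
  have htt : t ∈ Icc 0 t := ⟨ht.1, le_rfl⟩
  have het : Real.exp (-1 * t) ≤ 1 := Real.exp_le_one_iff.mpr (by linarith [ht.1])
  have het0 := Real.exp_pos (-1 * t)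
  -- upper barrier
  have hup : R t - A * Real.exp (-t) ≤ 1 + (ν - 1) / A ^ 2 * v t ^ 2 + M * t := by
    have h := le_mul_exp_of_deriv_right_le (β := -1)
      ((hEc.sub (((hv.fun_pow 2).mono hI).const_mul ((ν - 1) / A ^ 2))).sub (by fun_prop))
      (fun τ hτ => ((hE' τ hτ).sub ((hv2' τ hτ).const_mul ((ν - 1) / A ^ 2))).sub
        (((hasDerivAt_id' τ).const_mul M).hasDerivWithinAt)) (fun τ hτ => by
      obtain ⟨hN1, -⟩ := hNb τ hτ
      have h1 := mul_le_mul_of_nonneg_left (hvv τ hτ) (div_nonneg hν0 (sq_nonneg A))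
      have e1 : (ν - 1) / A ^ 2 * (A * v τ ^ 2) = (ν - 1) * (v τ ^ 2 / A) := by
        field_simp
      have h3 : 0 ≤ (ν - 1) / A ^ 2 * v τ ^ 2 := by positivity
      have h4 : 0 ≤ M * τ := mul_nonneg hM0 hτ.1
      simp only [Pi.sub_apply]
      linarith [hPτ2 τ hτ]) t htt
    simp only [Pi.sub_apply, neg_zero, Real.exp_zero, mul_one, mul_zero, sub_zero] at h
    have hf0 : R 0 - A - (ν - 1) / A ^ 2 * v 0 ^ 2 ≤ 1 := by
      linarith [(by positivity : 0 ≤ (ν - 1) / A ^ 2 * v 0 ^ 2)]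
    linarith [mul_le_mul_of_nonneg_right hf0 het0.le]
  -- lower barrier
  have hlow : -(1 + M * t) ≤ R t - A * Real.exp (-t) := by
    have h := exp_mul_le_of_le_deriv_right (β := -1) (hEc.add (by fun_prop))
      (fun τ hτ => (hE' τ hτ).add (((hasDerivAt_id' τ).const_mul M).hasDerivWithinAt))
      (fun τ hτ => by
        obtain ⟨-, hN2⟩ := hNb τ hτ
        have h4 : 0 ≤ M * τ := mul_nonneg hM0 hτ.1
        simp only [Pi.add_apply]
        linarith [hPτ2 τ hτ]) t htt
    simp only [Pi.add_apply, neg_zero, Real.exp_zero, mul_one, mul_zero, add_zero,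
      sub_zero] at h
    have hg0 : -1 ≤ R 0 - A := by linarith
    linarith [mul_le_mul_of_nonneg_right hg0 het0.le]
  -- numerics
  have h64 : (ν - 1) / A ^ 2 * v t ^ 2 ≤ (ν - 1) / 64 := by
    have : (ν - 1) / A ^ 2 * (A / 8) ^ 2 = (ν - 1) / 64 := by field_simp; ring
    rw [← this]
    exact mul_le_mul_of_nonneg_left (pow_le_pow_left₀ (hvp t ht) (hv8 t htt) 2) (by positivity)
  have hMt : M * t ≤ (ν - 1) / 2 + P * t / 2 + 4 * P * t := by
    have h1 : (ν - 1) * t ≤ (ν - 1) * (1 / 2) := mul_le_mul_of_nonneg_left (ht.2.trans hT) hν0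
    have h2 : (ν - 1) * (P * t) ≤ 1 * (P * t) :=
      mul_le_mul_of_nonneg_right (by linarith) (mul_nonneg hP ht.1)
    have : M * t = (ν - 1) * t + (ν - 1) * (P * t) / 2 + 4 * P * t := by rw [hM]; ring
    linarith
  have hPt : 0 ≤ P * t := mul_nonneg hP ht.1
  rw [abs_le]
  constructor <;> linarith

/-- **Post-flip pointwise bound.** With `D = U - W ≤ 0`, `0 ≤ V ≤ 2`, `|U + W - R| ≤ σB`:
`|(ν - 1) R + N / R| ≤ 8(ν - 1)/R + (ν - 1) σB/2 + 4P`, since `R² + D W = X + D σ/2` with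
`X = (2R - D)(R + D)/2 ∈ [0, 2V²]`. [folklore] -/
theorem gateR_flip_pointwise {U V W a b c P ν R σB : ℝ}
    (hR : Real.sqrt ((U - W) ^ 2 + 2 * V ^ 2) = R) (hR0 : 0 < R) (ha : |a| ≤ P) (hb : |b| ≤ P)
    (hc : 0 ≤ c ∧ c ≤ P) (hν1 : 1 ≤ ν) (hD : U - W ≤ 0) (hV0 : 0 ≤ V) (hV2 : V ≤ 2)
    (hσ : |U + W - R| ≤ σB) :
    |(ν - 1) * R + ((ν - 1) * (U - W) * W + ((U - W) * (a - b) + 2 * V * c)) / R| ≤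
      8 * (ν - 1) / R + (ν - 1) * σB / 2 + 4 * P := by
  have hR2 : R ^ 2 = (U - W) ^ 2 + 2 * V ^ 2 := by
    rw [← hR]; exact Real.sq_sqrt (by positivity)
  obtain ⟨hDR, hπ⟩ := gateR_pointwise hR hR0 ha hb hc
  have hν0 : 0 ≤ ν - 1 := sub_nonneg.2 hν1
  have hD1 := (abs_le.mp hDR).1
  have hX0 : 0 ≤ (2 * R - (U - W)) * (R + (U - W)) / 2 := by
    linarith [mul_nonneg (by linarith : 0 ≤ 2 * R - (U - W)) (by linarith : 0 ≤ R + (U - W))]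
  have hX1 : (2 * R - (U - W)) * (R + (U - W)) / 2 ≤ 2 * V ^ 2 := by
    have := mul_nonneg (by linarith : 0 ≤ R + (U - W)) (by linarith : 0 ≤ -(U - W))
    linear_combination this / 2 + hR2
  have hV4 : V ^ 2 ≤ 4 := (pow_le_pow_left₀ hV0 hV2 2).trans_eq (by norm_num)
  have hDσ : |(U - W) * (U + W - R)| ≤ R * σB := by
    rw [abs_mul]; exact mul_le_mul hDR hσ (abs_nonneg _) hR0.le
  obtain ⟨hDσ1, hDσ2⟩ := abs_le.mp hDσ
  have h1 := mul_le_mul_of_nonneg_left (by linarith : R ^ 2 + (U - W) * W ≤ 8 + R * σB / 2) hν0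
  have h2 := mul_le_mul_of_nonneg_left (by linarith : -(R * σB / 2) ≤ R ^ 2 + (U - W) * W) hν0
  have key : (ν - 1) * R + ((ν - 1) * (U - W) * W + ((U - W) * (a - b) + 2 * V * c)) / R =
      ((ν - 1) * (R ^ 2 + (U - W) * W) + ((U - W) * (a - b) + 2 * V * c)) / R := by
    field_simp
    ring
  have hBR : (8 * (ν - 1) / R + (ν - 1) * σB / 2 + 4 * P) * R =
      (ν - 1) * (8 + R * σB / 2) + 4 * P * R := by
    field_simp
  rw [key, abs_div, abs_of_pos hR0, div_le_iff₀ hR0, hBR]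
  obtain ⟨hπ1, hπ2⟩ := abs_le.mp hπ
  rw [abs_le]
  constructor <;> linarith

/-- **Post-flip regime (b).** If `u - w ≤ 0` and `v ≤ 2` on `[t₁, t]` (and `R ≥ A/3`,
`|u + w - R| ≤ 2 + 15(ν-1) + 6Pτ`, `v ≥ 0` on `[0, T]`, as supplied by `toda_gate_sigma`), then
`|R(t) - R(t₁) e^{-ν(t - t₁)}| ≤ 3 + 3(ν - 1) + 4P`: barriers at rate `-ν` for `E ∓ M(τ - t₁)`,
`E = R - R(t₁)e^{-ν(τ - t₁)}`, `M = 24(ν-1)/A + (ν-1)(2 + 15(ν-1) + 3P)/2 + 4P ≥ |R' + νR|`,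
and `M (t - t₁) ≤ M/2`. [folklore] -/
theorem gateR_flip {ν P T A t₁ t : ℝ} {u v w p r s : ℝ → ℝ} (hν1 : 1 ≤ ν)
    (hν2 : ν ≤ 2) (hP : 0 ≤ P) (hT : T ≤ 1 / 2) (hA : 1000 * (1 + P) ≤ A)
    (hu : ContinuousOn u (Icc 0 T)) (hv : ContinuousOn v (Icc 0 T))
    (hw : ContinuousOn w (Icc 0 T))
    (hu' : ∀ t ∈ Ico 0 T, HasDerivWithinAt u (-u t - v t ^ 2 + p t) (Ici t) t)
    (hv' : ∀ t ∈ Ico 0 T, HasDerivWithinAt v (v t * (u t - w t) - v t + s t) (Ici t) t)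
    (hw' : ∀ t ∈ Ico 0 T, HasDerivWithinAt w (-ν * w t + v t ^ 2 + r t) (Ici t) t)
    (hp : ∀ t ∈ Icc 0 T, |p t| ≤ P) (hr : ∀ t ∈ Icc 0 T, |r t| ≤ P)
    (hs : ∀ t ∈ Icc 0 T, 0 ≤ s t ∧ s t ≤ P) (hvp : ∀ t ∈ Icc 0 T, 0 ≤ v t)
    (hR3 : ∀ t ∈ Icc 0 T, A / 3 ≤ Real.sqrt ((u t - w t) ^ 2 + 2 * v t ^ 2))
    (hσ : ∀ t ∈ Icc 0 T, |u t + w t - Real.sqrt ((u t - w t) ^ 2 + 2 * v t ^ 2)| ≤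
      2 + 15 * (ν - 1) + 6 * P * t)
    (ht₁ : t₁ ∈ Icc 0 T) (ht : t ∈ Icc t₁ T)
    (hfl : ∀ t' ∈ Icc t₁ t, u t' - w t' ≤ 0 ∧ v t' ≤ 2) :
    |Real.sqrt ((u t - w t) ^ 2 + 2 * v t ^ 2) -
        Real.sqrt ((u t₁ - w t₁) ^ 2 + 2 * v t₁ ^ 2) * Real.exp (-ν * (t - t₁))| ≤
      3 + 3 * (ν - 1) + 4 * P := by
  set R : ℝ → ℝ := fun τ => Real.sqrt ((u τ - w τ) ^ 2 + 2 * v τ ^ 2) with hRdef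
  have hA0 : 0 < A := by linarith
  have hν0 : 0 ≤ ν - 1 := sub_nonneg.2 hν1
  have hI : Icc t₁ t ⊆ Icc 0 T := Icc_subset_Icc ht₁.1 ht.2
  have hI' : ∀ {τ}, τ ∈ Ico t₁ t → τ ∈ Ico 0 T := fun hτ =>
    ⟨ht₁.1.trans hτ.1, hτ.2.trans_le ht.2⟩
  have hRpos : ∀ τ ∈ Icc 0 T, 0 < R τ := fun τ hτ =>
    lt_of_lt_of_le (by positivity) (hR3 τ hτ)
  have hRc : ContinuousOn R (Icc t₁ t) :=
    ((((hu.sub hw).pow 2).add ((hv.pow 2).const_mul 2)).sqrt).mono hI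
  set M : ℝ := 24 * (ν - 1) / A + (ν - 1) * (2 + 15 * (ν - 1) + 3 * P) / 2 + 4 * P with hM
  have hM0 : 0 ≤ M := by positivity
  -- `E = R - R(t₁) e^{-ν(τ - t₁)}` has `E' = -ν E + q` with `|q| ≤ M`
  have hE' : ∀ τ ∈ Ico t₁ t,
      HasDerivWithinAt (fun y => R y - R t₁ * Real.exp (-ν * (y - t₁)))
        (-ν * (R τ - R t₁ * Real.exp (-ν * (τ - t₁))) + ((ν - 1) * R τ +
          ((ν - 1) * (u τ - w τ) * w τ + ((u τ - w τ) * (p τ - r τ) + 2 * v τ * s τ)) /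
            R τ)) (Ici τ) τ := fun τ hτ =>
    ((gateR_hasDerivWithinAt (hu' τ (hI' hτ)) (hv' τ (hI' hτ)) (hw' τ (hI' hτ)) rfl
      (hRpos τ (Ico_subset_Icc_self (hI' hτ)))).sub
      ((((hasDerivAt_id' τ).sub_const t₁).const_mul (-ν)).exp.const_mul (R t₁)
        |>.hasDerivWithinAt)).congr_deriv (by ring)
  have hEc : ContinuousOn (fun y => R y - R t₁ * Real.exp (-ν * (y - t₁))) (Icc t₁ t) :=
    hRc.sub (by fun_prop)
  have hq : ∀ τ ∈ Ico t₁ t, |(ν - 1) * R τ + ((ν - 1) * (u τ - w τ) * w τ +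
      ((u τ - w τ) * (p τ - r τ) + 2 * v τ * s τ)) / R τ| ≤ M := by
    intro τ hτ
    have hτ' : τ ∈ Icc 0 T := Ico_subset_Icc_self (hI' hτ)
    obtain ⟨hDτ, hvτ⟩ := hfl τ (Ico_subset_Icc_self hτ)
    have h := gateR_flip_pointwise rfl (hRpos τ hτ') (hp τ hτ') (hr τ hτ') (hs τ hτ') hν1
      hDτ (hvp τ hτ') hvτ (hσ τ hτ')
    have h1 : 8 * (ν - 1) / R τ ≤ 24 * (ν - 1) / A := by
      have := div_le_div_of_nonneg_left (by positivity : 0 ≤ 8 * (ν - 1)) (by positivity)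
        (hR3 τ hτ')
      have e : 8 * (ν - 1) / (A / 3) = 24 * (ν - 1) / A := by field_simp; ring
      linarith
    have h2 := mul_le_mul_of_nonneg_left (by nlinarith [hτ'.2.trans hT, hτ'.1] :
      2 + 15 * (ν - 1) + 6 * P * τ ≤ 2 + 15 * (ν - 1) + 3 * P) hν0
    linarith
  have htt : t ∈ Icc t₁ t := ⟨ht.1, le_rfl⟩
  have hMτ : ∀ τ ∈ Ico t₁ t, 0 ≤ ν * (M * (τ - t₁)) := fun τ hτ =>
    mul_nonneg (by linarith) (mul_nonneg hM0 (by linarith [hτ.1]))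
  -- upper barrier
  have hup : R t - R t₁ * Real.exp (-ν * (t - t₁)) ≤ M * (t - t₁) := by
    have h := le_mul_exp_of_deriv_right_le (β := -ν) (hEc.sub (by fun_prop))
      (fun τ hτ => (hE' τ hτ).sub
        ((((hasDerivAt_id' τ).sub_const t₁).const_mul M).hasDerivWithinAt))
      (fun τ hτ => by
        have h1 := (abs_le.mp (hq τ hτ)).2
        simp only [Pi.sub_apply]
        linarith [hMτ τ hτ]) t htt
    simp only [Pi.sub_apply, sub_self, mul_zero, Real.exp_zero, mul_one, zero_mul] at h
    linarith
  -- lower barrier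
  have hlow : -(M * (t - t₁)) ≤ R t - R t₁ * Real.exp (-ν * (t - t₁)) := by
    have h := exp_mul_le_of_le_deriv_right (β := -ν) (hEc.add (by fun_prop))
      (fun τ hτ => (hE' τ hτ).add
        ((((hasDerivAt_id' τ).sub_const t₁).const_mul M).hasDerivWithinAt))
      (fun τ hτ => by
        have h1 := (abs_le.mp (hq τ hτ)).1
        simp only [Pi.add_apply]
        linarith [hMτ τ hτ]) t htt
    simp only [Pi.add_apply, sub_self, mul_zero, Real.exp_zero, mul_one, zero_mul,
      add_zero] at h
    linarith
  -- numerics: `M (t - t₁) ≤ M / 2 ≤ 3 + 3 (ν - 1) + 4 P`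
  have hMt : M * (t - t₁) ≤ M * (1 / 2) :=
    mul_le_mul_of_nonneg_left (by linarith [ht.2, hT, ht₁.1]) hM0
  have hM2 : M * (1 / 2) ≤ 3 + 3 * (ν - 1) + 4 * P := by
    have h1 : 24 * (ν - 1) / A ≤ ν - 1 := by rw [div_le_iff₀ hA0]; nlinarith
    have h2 : (ν - 1) * (ν - 1) ≤ ν - 1 := by nlinarith
    have h3 : (ν - 1) * P ≤ 1 * P := mul_le_mul_of_nonneg_right (by linarith) hP
    rw [hM]
    nlinarith
  rw [abs_le]
  constructor <;> linarith

/-- **GATE RADIUS TRACKING.** In the setting of `toda_gate_sigma`, the gate radius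
`R = √((u−w)² + 2v²)` obeys EXACTLY `R' = −k_R R + (ν−1)v²/R + (ν−1)Dσ/(2R) + π_R` with
`k_R = ((1+ν)R − (ν−1)D)/(2R) ∈ [1, ν]` (`= 1` while the energy sits in the old carrier, `D = R`;
`= ν` once it sits in the new one, `D = −R`), `|π_R| ≤ 4P` (`R = S − σ`, `S' = −u − νw + p + r`, and the
σ-identity). Hence: (a) during the RISE (`v ≤ A/8` so far) `R` follows the free decay `A e^{−t}` of the old
carrier up to an ABSOLUTE error; (b) after the FLIP (`u − w ≤ 0` and `v ≤ 2` on `[t₁, t]`) `R` decays at the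
new carrier's rate `ν` up to an absolute error — the new carrier `w = (R + σ − D)/2 ∈ [R + σ/2 − v²/R, R + σ/2]`
is thereby pinned to `O(1)`. (Assembly: `toda_gate_sigma` gives `v ≥ 0`, `w ≥ −Pt`, `R ≥ A/3`, the
`σ`-bound; (a) is `gateR_rise` on the brackets of `riseClock_boot`/`riseClock_phase`, (b) is `gateR_flip`.)
[folklore] -/
theorem toda_gate_R :
    ∀ (ν P T A : ℝ) (u v w p r s : ℝ → ℝ),
    1 ≤ ν → ν ≤ 2 → 0 ≤ P → 0 < T → T ≤ 1 / 2 → 1000 * (1 + P) ≤ A →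
    u 0 = A → 0 ≤ w 0 → w 0 ≤ 1 → 0 < v 0 → v 0 ≤ 1 →
    ContinuousOn u (Set.Icc 0 T) → ContinuousOn v (Set.Icc 0 T) → ContinuousOn w (Set.Icc 0 T) →
    (∀ t ∈ Set.Ico 0 T, HasDerivWithinAt u (-u t - v t ^ 2 + p t) (Set.Ici t) t) →
    (∀ t ∈ Set.Ico 0 T, HasDerivWithinAt v (v t * (u t - w t) - v t + s t) (Set.Ici t) t) →
    (∀ t ∈ Set.Ico 0 T, HasDerivWithinAt w (-ν * w t + v t ^ 2 + r t) (Set.Ici t) t) →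
    (∀ t ∈ Set.Icc 0 T, |p t| ≤ P) → (∀ t ∈ Set.Icc 0 T, |r t| ≤ P) →
    (∀ t ∈ Set.Icc 0 T, 0 ≤ s t ∧ s t ≤ P) →
    (∀ t ∈ Set.Icc 0 T, (∀ t' ∈ Set.Icc 0 t, v t' ≤ A / 8) →
      |Real.sqrt ((u t - w t) ^ 2 + 2 * v t ^ 2) - A * Real.exp (-t)| ≤ 3 + 25 * (ν - 1) + 8 * P * t) ∧
    (∀ t₁ ∈ Set.Icc 0 T, ∀ t ∈ Set.Icc t₁ T, (∀ t' ∈ Set.Icc t₁ t, u t' - w t' ≤ 0 ∧ v t' ≤ 2) →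
      |Real.sqrt ((u t - w t) ^ 2 + 2 * v t ^ 2) -
          Real.sqrt ((u t₁ - w t₁) ^ 2 + 2 * v t₁ ^ 2) * Real.exp (-ν * (t - t₁))| ≤
        3 + 3 * (ν - 1) + 4 * P) := by
  intro ν P T A u v w p r s hν1 hν2 hP hT0 hT hA hu0 hw0 hw1 hv0 hv1 hu hv hw hu' hv' hw' hp
    hr hs
  have hsig := toda_gate_sigma ν P T A u v w p r s hν1 hν2 hP hT0 hT hA hu0 hw0 hw1 hv0 hv1 hu hv
    hw hu' hv' hw' hp hr hs
  have hvp : ∀ t ∈ Icc 0 T, 0 ≤ v t := fun t ht => (hsig t ht).1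
  refine ⟨fun t ht hv8 => ?_, fun t₁ ht₁ t ht hfl => ?_⟩
  · have hs0 : ∀ τ ∈ Icc 0 T, 0 ≤ s τ := fun τ hτ => (hs τ hτ).1
    have hD := riseClock_boot hν1 hP hT (by linarith) hu0 hw0 hw1 hv0 hu hv hw hu' hv' hw' hp hr
      hs0 ht hv8
    have hlin := riseClock_lin hν1 hP hu0 hw0 hv0 hu hv hw hu' hv' hw' hp hr hs0
    have hph := riseClock_phase hν1 hP (by linarith) ht.2 hu0 hw1 hu hv hw hu' hv' hw' hp hr hs0
      (fun x hx => (hlin x hx).1) (fun x hx => hD x (Ico_subset_Icc_self hx))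
    exact gateR_rise hν1 hν2 hP hT hA hu0 hw0 hw1 hv1 hu hv hw hu' hv' hw' hp hr hs hvp
      (fun τ hτ => (hsig τ hτ).2.1) ht hv8 hD (fun τ hτ => (hph τ hτ).2)
  · exact gateR_flip hν1 hν2 hP hT hA hu hv hw hu' hv' hw' hp hr hs hvp
      (fun τ hτ => (hsig τ hτ).2.2.2.2.1) (fun τ hτ => (hsig τ hτ).2.2.2.2.2) ht₁ ht hfl

end Summit.NavierStokesRegularity.NavierStokesRegularity.Theorems.PerpetualPumpCircuitPump
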